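import Literature.NumberTheory.Transcendental.KZGaussMultiplicationChain
import Literature.NumberTheory.Transcendental.KZBetaChains
import HarnessLib

/-!
# `MultiplicationAccessible` (stmt-KontsevichZagierPeriods-12305), line `shifted-family-prime-sieve`,
stub `stub_dirichletSimplex`

The BRIDGE, second half (`n = m + 1`, rational `s > 0`): the Beta box
`q = [(0,1)^m, n^{ns−1} ∏ⱼ zⱼ^{(j+1)s−1}(1 − zⱼ)^{s−1}]` is KZ-equivalent to the crux's big-simplex
representation `r' = [{σ > 0, Σσ < n}, (∏σⱼ · (n − Σσⱼ))^{s−1}]`.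

Proof in the formal period ring `P = KZ.FormalPeriodRing` (`KZ.toFormalPeriod_eq_iff`:
`KZ.Equivalent q r' ↔ ⟦q⟧ = ⟦r'⟧`), `κ = n^{ns−1}` (real algebraic, `KZ.isAlgebraic_gaussMultConst`):

* box side: `q` is congruent (`KZ.of_sub_of_mem_relations_of_eqOn`) to `κ · R` for the cube Beta
  representation `R = [(0,1)^m, ∏ⱼ zⱼ^{(j+1)s−1}(1 − zⱼ)^{s−1}]` (`KZ.exists_cubeBetaRep`), and
  `⟦κ · R⟧ = ⟦[pt, κ]⟧ · ∏ⱼ ⟦β((j+1)s, s)⟧` (`KZ.toFormalPeriod_of_constMul`,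
  `KZ.cubeBetaRep_toFormalPeriod_eq_prod`);
* simplex side: `⟦r'⟧ = ⟦[pt, κ]⟧ · ∏ⱼ ⟦β(s, (j+1)s)⟧` (`KZ.bigSimplex_toFormalPeriod`: the scaling
  `σ = n u` onto Dirichlet's representation and its peeling onto Beta classes);
* `⟦β((j+1)s, s)⟧ = ⟦β(s, (j+1)s)⟧` by the reflection `t ↦ 1 − t` (`KZ.betaReflection_equivalent`).

References: Kontsevich–Zagier 2001 §1.2 (rules (1)–(2)), §4.1; Andrews–Askey–Roy 1999 Thm 1.8.1
(Dirichlet's integral). Sorry-free; no `def`; axioms ⊆ {propext, Classical.choice, Quot.sound}.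
-/

noncomputable section

open MeasureTheory Set
open Literature.NumberTheory.Transcendental
open Literature.NumberTheory.Transcendental.KZ

namespace Summit.KontsevichZagierPeriods.TerasomaMultiplication.MultiplicationAccessible

/-- **The Beta box `∼` the big simplex** (bridge, second half, of line `shifted-family-prime-sieve`):
for `m : ℕ` (`n = m + 1`) and rational `s > 0`, every representation pinned as
`q = [(0,1)^m, n^{ns−1} ∏ⱼ zⱼ^{(j+1)s−1}(1 − zⱼ)^{s−1}]` is KZ-equivalent to every representation
pinned as `r' = [{σ > 0, Σσ < n}, (∏σⱼ · (n − Σσⱼ))^{s−1}]`. In the formal period ring both classes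
equal `⟦[pt, n^{ns−1}]⟧ · ∏ⱼ ⟦β(s, (j+1)s)⟧`: the box side by congruence with `n^{ns−1} · R_box`,
`KZ.toFormalPeriod_of_constMul`, `KZ.cubeBetaRep_toFormalPeriod_eq_prod` and the reflections
`β((j+1)s, s) ∼ β(s, (j+1)s)` (`KZ.betaReflection_equivalent`); the simplex side is
`KZ.bigSimplex_toFormalPeriod` (scaling onto Dirichlet's representation, peeled onto Beta classes).
Value identity: `n^{ns−1} ∏_{j<m} B((j+1)s, s) = n^{ns−1} Γ(s)^n / Γ(ns) = ∫_{S_m} (∏σⱼ(n−Σσⱼ))^{s−1}`.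
The hypothesis `1 ≤ m` is not used. [cite: AndrewsAskeyRoy1999, Thm 1.8.1] -/
theorem stub_dirichletSimplex :
    ∀ (m : ℕ) (s : ℚ), 1 ≤ m → 0 < s → ∀ (q r' : KZ.IntegralRep m),
      q.domain = {z | ∀ i, z i ∈ Set.Ioo (0:ℝ) 1} →
      Set.EqOn q.integrand (fun z => ((m:ℝ) + 1) ^ (((m:ℝ) + 1) * (s:ℝ) - 1) *
        ∏ j : Fin m, (z j) ^ ((((j:ℕ):ℝ) + 1) * (s:ℝ) - 1) * (1 - z j) ^ ((s:ℝ) - 1)) q.domain →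
      r'.domain = {x | (∀ i, 0 < x i) ∧ ∑ i, x i < (m:ℝ) + 1} →
      Set.EqOn r'.integrand (fun x => ((∏ i, x i) * ((m:ℝ) + 1 - ∑ i, x i)) ^ ((s:ℝ) - 1))
        r'.domain →
      KZ.Equivalent q r' := by
  intro m s _ hs q r' hqd hqi hr'd hr'i
  -- the constant `κ = n^{ns-1}` is real algebraic
  have hκ : IsAlgebraic ℚ (((m:ℝ) + 1) ^ (((m:ℝ) + 1) * (s:ℝ) - 1)) :=
    isAlgebraic_gaussMultConst m s
  -- the exponents `b j = (j+1) s`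
  obtain ⟨b, hb⟩ : ∃ b : Fin m → ℚ, ∀ j, b j = (((j : ℕ) : ℚ) + 1) * s := ⟨_, fun j => rfl⟩
  have hbR : ∀ j : Fin m, ((b j : ℚ) : ℝ) = (((j:ℕ):ℝ) + 1) * (s:ℝ) := fun j => by
    rw [hb]; push_cast; ring
  have hpos : ∀ j : Fin m, 0 < b j ∧ 0 < s := fun j => ⟨by rw [hb]; positivity, hs⟩
  -- BOX SIDE: the cube Beta representation `R = [(0,1)^m, ∏ⱼ zⱼ^{b_j-1}(1-zⱼ)^{s-1}]`
  obtain ⟨R, hRd, hRi⟩ := exists_cubeBetaRep b (fun _ => s) hpos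
  -- `q ∼ κ · R` by congruence (same domain, integrands agree on it)
  have hqR : KZ.Equivalent q (R.constMul _ hκ) := by
    refine of_sub_of_mem_relations_of_eqOn ?_ fun z hz => ?_
    · rw [IntegralRep.domain_constMul, hRd, hqd]
    · have hzR : z ∈ R.domain := by
        rw [hRd]
        rw [hqd] at hz
        exact hz
      rw [hqi hz, IntegralRep.integrand_constMul]
      dsimp only
      rw [hRi hzR]
      congr 1
      exact Finset.prod_congr rfl fun j _ => by rw [hbR]
  -- the one-variable Beta representations `β(b_j, s)` (box side) and `β(s, b_j)` (simplex side)
  have hβL : ∀ j : Fin m, ∃ B : KZ.IntegralRep 1, B.domain = {t | t 0 ∈ Set.Ioo (0:ℝ) 1} ∧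
      B.integrand = fun t => (t 0) ^ (((b j : ℚ) : ℝ) - 1) * (1 - t 0) ^ ((s:ℝ) - 1) :=
    fun j => exists_betaRep' (b j) s (hpos j).1 hs
  choose βL hβLd hβLi using hβL
  have hβR : ∀ j : Fin m, ∃ B : KZ.IntegralRep 1, B.domain = {t | t 0 ∈ Set.Ioo (0:ℝ) 1} ∧
      B.integrand = fun t => (t 0) ^ ((s:ℝ) - 1) * (1 - t 0) ^ (((b j : ℚ) : ℝ) - 1) :=
    fun j => exists_betaRep' s (b j) hs (hpos j).1
  choose βR hβRd hβRi using hβR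
  -- `⟦q⟧ = ⟦[pt, κ]⟧ · ∏ ⟦βL j⟧`
  have hbox : toFormalPeriod (of q) =
      toFormalPeriod (of (IntegralRep.unit.constMul _ hκ)) * ∏ j, toFormalPeriod (of (βL j)) := by
    rw [hqR.toFormalPeriod_eq, toFormalPeriod_of_constMul,
      cubeBetaRep_toFormalPeriod_eq_prod b (fun _ => s) hpos R βL hRd hRi hβLd
        (fun j t _ => by rw [hβLi])]
  -- SIMPLEX SIDE: `⟦r'⟧ = ⟦[pt, κ]⟧ · ∏ ⟦βR j⟧`
  have hspx : toFormalPeriod (of r') =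
      toFormalPeriod (of (IntegralRep.unit.constMul _ hκ)) * ∏ j, toFormalPeriod (of (βR j)) :=
    bigSimplex_toFormalPeriod m s hs r' hr'd hr'i b hb βR hβRd (fun j t _ => by rw [hβRi]) hκ
  -- REFLECTION: `⟦βL j⟧ = ⟦βR j⟧`
  have hrefl : ∀ j, toFormalPeriod (of (βL j)) = toFormalPeriod (of (βR j)) := fun j =>
    (betaReflection_equivalent (((b j : ℚ) : ℝ) - 1) ((s:ℝ) - 1) (βL j) (βR j) (hβLd j)
      (fun t _ => by rw [hβLi]) (hβRd j) (fun t _ => by rw [hβRi])).toFormalPeriod_eq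
  -- conclude in `P`
  have h : toFormalPeriod (of q) = toFormalPeriod (of r') := by
    rw [hbox, hspx]
    congr 1
    exact Finset.prod_congr rfl fun j _ => hrefl j
  exact toFormalPeriod_eq_iff.mp h

end Summit.KontsevichZagierPeriods.TerasomaMultiplication.MultiplicationAccessible
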